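import Literature.Geometry.Lorentzian.CoordGaussianSlice
import Literature.Geometry.Lorentzian.CoordKIDEquations
import Literature.Geometry.Lorentzian.CoordDeformationWave
import HarnessLib

/-!
# The Cauchy data of the Killing defect: Killing initial data give `A = ∂_t A = 0` on the slice

The algebraic heart of the theorem that **Killing initial data develop into Killing fields**
(Moncrief 1975, §III; Coll 1977; Fischer–Marsden–Moncrief 1980, Lemma 2.2: "on the Cauchy
hypersurface `h̄` and its normal derivative vanish by the KID equations"), in the coordinate tensor
calculus of the tree. Let `G` be a metric on `T ⊆ ℝ × F` in second-order Gaussian form along the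
slice `Σ = {0} × B` (`GaussSlice.IsGaussianSlice`, `CoordGaussianSlice.lean`: `G(e₀,e₀) = −1`,
`G(e₀, ṽ) = 0`, `∂_t G(e₀, ·) = 0` on `Σ`; induced metric `h = sliceMetric G`, second fundamental
form `K = sliceK G`), and let `Θ` be a covector field on `T` (in the application a solution of the
wave equation `□Θ = 0`) whose Cauchy data on `Σ` are those attached to a pair `(N, Y)` on `B`:

  `Θ(e₀) = −2N`, `Θ(ṽ) = h(Y, v)`, `∂_tΘ(e₀) = 0`, `∂_tΘ(ṽ) = −∂_ṽΘ(e₀) + 2Θ(Γ(e₀, ṽ))`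

(`IsKIDCauchyData`; the space-time covector `Θ = (2N ν + Y)♭` in the tree's normalisation of KIDs,
`CoordKIDEquations.lean`, and the time derivatives chosen so that the normal rows of the defect
vanish). The **Killing defect** `kdef G Θ (X, Y) = DΘ(X)(Y) + DΘ(Y)(X) − 2Θ(Γ(X,Y))` (the form
`∇_a Θ_b + ∇_b Θ_a`; its components in a basis are the deformation tensor `deform` of
`CoordDeformationWave.lean`, `deform_covecComp`) then satisfies on `Σ`:

* `kdef(e₀, ·) = 0` (`kdef_tvec`), and **`kdef(ṽ, w̃) = 𝓛_Y h(v,w) + 4N K(v,w)`**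
  (`kdef_svec_svec`) — zero by the first KID equation (`lieFormAt_metric_eq_of_kidK`);
* **`∂_t kdef(ṽ, w̃) = 4 (Hess_h N − N Ric_h − N (tr K) K + 2N K∘♯K + ½ 𝓛_Y K)(v, w)
  + 4N Ric_G(ṽ, w̃)`** (`fderiv_tvec_kdef_svec_svec`) — zero in vacuum by the second KID equation
  (`kid₂_eq_zero`);
* the normal rows `∂_t kdef(e₀, ·)` vanish as soon as `□Θ = 0` and `Ric_G = 0` at the slice point
  and the tangential block and its time derivative vanish — the contracted Ricci identity
  `div A − ½ d tr A = □Θ + Ric(Θ♯, ·)` (`trace_tcov_deform_sub_half`) read on `Σ`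
  (`fderiv_tvec_deform_none`);

so that for vacuum `G`, vacuum constraints and KID equations for `(N, Y)` and `□Θ = 0`, **all
components of `A = deform Θ` and of `∂_t A` vanish on `Σ`** (`deform_cauchyData_eq_zero`). With
the wave equation `□A = −(X + Xᵗ)A` (`tlap_deform_eq_of_tlap_eq_zero`) and uniqueness for linear
wave systems this gives `A = 0`, i.e. `Θ♯` is a Killing field near `Σ`. Everything is proved; the
only definitions are the explicit expressions `covecComp`, `kdef` and the data predicate
`IsKIDCauchyData`.

## References

* V. Moncrief, *Spacetime symmetries and linearization stability of the Einstein equations. I*,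
  J. Math. Phys. 16 (1975) 493–498, §III. [Moncrief1975]
* A. E. Fischer, J. E. Marsden, V. Moncrief, Ann. Inst. H. Poincaré A 33 (1980) 147–194, §2,
  Lemma 2.2 and its proof. [FischerMarsdenMoncrief1980]
* R. M. Wald, *General Relativity*, Chicago 1984, §10.2, App. C.2–C.3. [Wald1984]
-/

noncomputable section

-- nested operator spaces `(ℝ × F) →L[ℝ] (ℝ × F) →L[ℝ] (ℝ × F) →L[ℝ] ℝ` (second derivatives)
set_option maxSynthPendingDepth 3

open Set Filter ContinuousLinearMap Module Function
open scoped Topology ContDiff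

namespace Literature.Geometry.Lorentzian

namespace MetricCoord

/-! ### The Killing defect of a covector field and its components -/

section Defect

variable {E : Type*} [NormedAddCommGroup E] [NormedSpace ℝ E] {ι : Type*}
  (G : E → E →L[ℝ] E →L[ℝ] ℝ) (b : Basis ι ℝ E)

/-- **Components of a covector field** `Θ` in the basis `b`, as a rank-one coordinate tensor
(`T_m = Θ(b_m)`, index type `Unit`). [folklore] -/
def covecComp (Θ : E → E →L[ℝ] ℝ) : E → (Unit → ι) → ℝ :=
  fun x I ↦ Θ x (b (I ()))

/-- **The Killing defect** of a covector field: `kdef Θ (X, Y) = DΘ(X)(Y) + DΘ(Y)(X) − 2 Θ(Γ(X,Y))`,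
i.e. `(∇_X Θ)(Y) + (∇_Y Θ)(X)` for the torsion-free `Γ` (for `Θ = ξ♭`: `𝓛_ξ g (X, Y)`).
[cite: Wald1984, (C.2.16)] -/
def kdef (Θ : E → E →L[ℝ] ℝ) (x X Y : E) : ℝ :=
  fderiv ℝ Θ x X Y + fderiv ℝ Θ x Y X - 2 * Θ x (chrAt G x X Y)

variable {G b} {V : Set E} {x : E}

/-- Unfolding lemma for `covecComp`. [folklore] -/
@[simp] theorem covecComp_apply (Θ : E → E →L[ℝ] ℝ) (x : E) (I : Unit → ι) :
    covecComp b Θ x I = Θ x (b (I ())) := rfl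

/-- Unfolding lemma for `kdef`. [cite: Wald1984, (C.2.16)] -/
theorem kdef_apply (Θ : E → E →L[ℝ] ℝ) (x X Y : E) :
    kdef G Θ x X Y = fderiv ℝ Θ x X Y + fderiv ℝ Θ x Y X - 2 * Θ x (chrAt G x X Y) := rfl

/-- The Killing defect is symmetric. [cite: Wald1984, (C.2.16)] -/
theorem IsMetricOn.kdef_comm (hG : IsMetricOn G V) (hx : x ∈ V) (Θ : E → E →L[ℝ] ℝ) (X Y : E) :
    kdef G Θ x X Y = kdef G Θ x Y X := by
  rw [kdef_apply, kdef_apply, hG.chrAt_comm hx]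
  ring

/-- The components of a `C^∞` covector field are a smooth tensor field. [folklore] -/
theorem tsmoothOn_covecComp {Θ : E → E →L[ℝ] ℝ} (hΘ : ContDiffOn ℝ ∞ Θ V) :
    TSmoothOn (covecComp b Θ) V :=
  fun _ ↦ hΘ.clm_apply contDiffOn_const

variable [Fintype ι]

/-- **The deformation tensor of the components is the Killing defect on basis vectors**:
`(deform Θ)_{ji} = kdef Θ (b_j, b_i)`. [cite: Wald1984, (C.2.16)] -/
theorem IsMetricOn.deform_covecComp [CompleteSpace E] (hG : IsMetricOn G V) (hx : x ∈ V)
    {Θ : E → E →L[ℝ] ℝ} (hΘ : DifferentiableAt ℝ Θ x) (j i : ι) :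
    deform G b (covecComp b Θ) x (ocons j (uidx i)) = kdef G Θ x (b j) (b i) := by
  have hsum : ∀ p m, ∑ c, chrCoef G b x p m c * covecComp b Θ x (uidx c) =
      Θ x (chrAt G x (b p) (b m)) := by
    intro p m
    rw [chrAt_basis_eq_sum b x p m, map_sum]
    refine Finset.sum_congr rfl fun c _ ↦ ?_
    rw [map_smul, smul_eq_mul, covecComp_apply]
  rw [deform_apply, tcov_apply_uidx, tcov_apply_uidx, hsum, hsum, kdef_apply,
    hG.chrAt_comm hx (b i) (b j)]
  simp only [covecComp_apply]
  rw [fderiv_clm_apply_const hΘ (b i) (b j), fderiv_clm_apply_const hΘ (b j) (b i)]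
  ring

end Defect

/-! ### Cauchy data of KID type on a Gaussian slice -/

namespace GaussSlice

variable {F : Type*} [NormedAddCommGroup F] [NormedSpace ℝ F]
  (G : ℝ × F → (ℝ × F) →L[ℝ] (ℝ × F) →L[ℝ] ℝ) (Θ : ℝ × F → (ℝ × F) →L[ℝ] ℝ)
  (N : F → ℝ) (Y : F → F) (B : Set F)

/-- **Cauchy data of KID type** for a covector field `Θ` along the slice `{0} × B`: the values
`Θ(e₀) = −2N`, `Θ(ṽ) = h(Y, v)` of the space-time covector `(2N ν + Y)♭` attached to the pair
`(N, Y)` (the tree's normalisation of KIDs, `CoordKIDEquations.lean`), and the time derivatives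
`∂_tΘ(e₀) = 0`, `∂_tΘ(ṽ) = −∂_ṽΘ(e₀) + 2Θ(Γ(e₀,ṽ))` which make the normal rows of the Killing
defect vanish on the slice (Fischer–Marsden–Moncrief 1980, proof of Lemma 2.2: "`X` with Cauchy
data `(X⊥, X∥)` and time derivative determined by `h̄ = 0` on `Σ`").
[cite: FischerMarsdenMoncrief1980, Lemma 2.2] -/
structure IsKIDCauchyData : Prop where
  val_tvec : ∀ y ∈ B, Θ (svec y) tvec = -2 * N y
  val_svec : ∀ y ∈ B, ∀ v : F, Θ (svec y) (svec v) = sliceMetric G y (Y y) v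
  dt_tvec : ∀ y ∈ B, fderiv ℝ Θ (svec y) tvec tvec = 0
  dt_svec : ∀ y ∈ B, ∀ v : F, fderiv ℝ Θ (svec y) tvec (svec v) =
    -fderiv ℝ Θ (svec y) (svec v) tvec + 2 * Θ (svec y) (chrAt G (svec y) tvec (svec v))

variable {G Θ N Y B} {T : Set (ℝ × F)} {y : F}

section ZerothOrder

variable (hG : IsMetricOn G T) (hS : IsGaussianSlice G B) (hD : IsKIDCauchyData G Θ N Y B)
include hG hS hD

omit hS in
/-- **`kdef(e₀, e₀) = 0` on the slice.** [cite: FischerMarsdenMoncrief1980, Lemma 2.2] -/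
theorem kdef_tvec_tvec (hB : IsOpen B) (hBT : ∀ y ∈ B, svec y ∈ T) (hS : IsGaussianSlice G B)
    (hy : y ∈ B) : kdef G Θ (svec y) tvec tvec = 0 := by
  rw [kdef_apply, hD.dt_tvec y hy, chrAt_tvec_tvec hG hS hB hBT hy, map_zero]
  ring

omit hG hS in
/-- **`kdef(e₀, ṽ) = 0` on the slice.** [cite: FischerMarsdenMoncrief1980, Lemma 2.2] -/
theorem kdef_tvec_svec (hy : y ∈ B) (v : F) : kdef G Θ (svec y) tvec (svec v) = 0 := by
  rw [kdef_apply, hD.dt_svec y hy v]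
  ring

omit hS in
/-- `kdef(ṽ, e₀) = 0` on the slice. [cite: FischerMarsdenMoncrief1980, Lemma 2.2] -/
theorem kdef_svec_tvec (hBT : ∀ y ∈ B, svec y ∈ T) (hy : y ∈ B) (v : F) :
    kdef G Θ (svec y) (svec v) tvec = 0 := by
  rw [hG.kdef_comm (hBT y hy), kdef_tvec_svec hD hy]

omit hS in
/-- **`kdef(e₀, W) = 0`** on the slice for every `W`. [cite: FischerMarsdenMoncrief1980, Lemma 2.2] -/
theorem kdef_tvec (hB : IsOpen B) (hBT : ∀ y ∈ B, svec y ∈ T) (hS : IsGaussianSlice G B)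
    (hy : y ∈ B) (W : ℝ × F) : kdef G Θ (svec y) tvec W = 0 := by
  have h1 : kdef G Θ (svec y) tvec W = W.1 * kdef G Θ (svec y) tvec tvec +
      kdef G Θ (svec y) tvec (svec W.2) := by
    conv_lhs => rw [eq_smul_tvec_add_svec W]
    simp only [kdef_apply, map_add, map_smul, _root_.add_apply, _root_.smul_apply, smul_eq_mul]
    ring
  rw [h1, kdef_tvec_tvec hG hD hB hBT hS hy, kdef_tvec_svec hD hy]
  ring

omit hG hS hD in
/-- Tangential derivative of `Θ(W)` along the slice: `DΘ_{(0,y)}(ṽ)(W) = ∂_v (Θ(0,·)(W))(y)`.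
[folklore] -/
theorem fderiv_svec_apply (hΘ : DifferentiableAt ℝ Θ (svec y)) (v : F) (W : ℝ × F) :
    fderiv ℝ Θ (svec y) (svec v) W = fderiv ℝ (fun y' : F ↦ Θ (svec y') W) y v := by
  have hd : DifferentiableAt ℝ (fun x ↦ Θ x W) (svec y) := differentiableAt_clm_apply_const hΘ W
  rw [fderiv_comp_svec hd, fderiv_clm_apply_const hΘ W]

omit hG hS in
/-- **`DΘ(ṽ)(e₀) = −2 ∂_v N`** on the slice. [cite: FischerMarsdenMoncrief1980, Lemma 2.2] -/
theorem fderiv_svec_tvec_eq (hB : IsOpen B) (hΘ : DifferentiableAt ℝ Θ (svec y))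
    (hN : DifferentiableAt ℝ N y) (hy : y ∈ B) (v : F) :
    fderiv ℝ Θ (svec y) (svec v) tvec = -2 * fderiv ℝ N y v := by
  rw [fderiv_svec_apply hΘ]
  have heq : (fun y' : F ↦ Θ (svec y') tvec) =ᶠ[𝓝 y] fun y' ↦ (-2 : ℝ) * N y' :=
    Filter.eventually_of_mem (hB.mem_nhds hy) fun y' hy' ↦ hD.val_tvec y' hy'
  rw [heq.fderiv_eq, fderiv_const_mul hN]
  simp [smul_eq_mul]

omit hS in
/-- **`DΘ(ṽ)(w̃) = ∂_v h(Y, w) = (∂_v h)(Y, w) + h(∂_v Y, w)`** on the slice.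
[cite: FischerMarsdenMoncrief1980, Lemma 2.2] -/
theorem fderiv_svec_svec_eq (hB : IsOpen B) (hBT : ∀ y ∈ B, svec y ∈ T)
    (hΘ : DifferentiableAt ℝ Θ (svec y)) (hY : DifferentiableAt ℝ Y y) (hy : y ∈ B) (v w : F) :
    fderiv ℝ Θ (svec y) (svec v) (svec w) =
      fderiv ℝ (sliceMetric G) y v (Y y) w + sliceMetric G y (fderiv ℝ Y y v) w := by
  rw [fderiv_svec_apply hΘ]
  have heq : (fun y' : F ↦ Θ (svec y') (svec w)) =ᶠ[𝓝 y] fun y' ↦ sliceMetric G y' (Y y') w :=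
    Filter.eventually_of_mem (hB.mem_nhds hy) fun y' hy' ↦ hD.val_svec y' hy' w
  rw [heq.fderiv_eq]
  have hh := differentiableAt_sliceMetric hG hBT hy
  have hprod : HasFDerivAt (fun y' ↦ sliceMetric G y' (Y y'))
      ((sliceMetric G y).comp (fderiv ℝ Y y) + (fderiv ℝ (sliceMetric G) y).flip (Y y)) y :=
    hh.hasFDerivAt.clm_apply hY.hasFDerivAt
  rw [(hasFDerivAt_clm_apply_const hprod w).fderiv]
  simp only [ContinuousLinearMap.comp_apply, _root_.add_apply, ContinuousLinearMap.flip_apply]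
  ring

/-- **The tangential block of the Killing defect on the slice**:
`kdef(ṽ, w̃) = 𝓛_Y h (v, w) + 4 N K(v, w)` (so it vanishes by the first KID equation
`𝓛_Y h = −4N K`). [cite: FischerMarsdenMoncrief1980, Lemma 2.2] -/
theorem kdef_svec_svec [FiniteDimensional ℝ F] (hB : IsOpen B) (hBT : ∀ y ∈ B, svec y ∈ T)
    (hΘ : DifferentiableAt ℝ Θ (svec y)) (hY : DifferentiableAt ℝ Y y) (hy : y ∈ B) (v w : F) :
    kdef G Θ (svec y) (svec v) (svec w) =
      lieFormAt (sliceMetric G) Y y v w + 4 * N y * sliceK G y v w := by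
  have hh := isMetricOn_sliceMetric hG hS hB hBT
  have hx := hBT y hy
  rw [kdef_apply, fderiv_svec_svec_eq hG hD hB hBT hΘ hY hy, fderiv_svec_svec_eq hG hD hB hBT hΘ hY hy,
    chrAt_svec_svec hG hS hB hBT hy, map_add, map_smul, hD.val_tvec y hy, hD.val_svec y hy,
    lieFormAt_apply, hh.symm y hy (Y y) (chrAt (sliceMetric G) y v w),
    apply_chrAt (hh.isInvertible y hy), koszulCLM_apply, hh.fderiv_symm hy v (Y y) w,
    hh.fderiv_symm hy w (Y y) v, hh.symm y hy (fderiv ℝ Y y w) v]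
  simp only [smul_eq_mul]
  ring

end ZerothOrder

/-! ### The time derivative of the tangential block -/

section Smooth

variable (hG : IsMetricOn G T) (hΘ : ContDiffOn ℝ ∞ Θ T)
include hG hΘ

/-- `Θ` is differentiable at the points of `T`. [folklore] -/
theorem differentiableAt_covec {x : ℝ × F} (hx : x ∈ T) : DifferentiableAt ℝ Θ x :=
  ((hΘ x hx).contDiffAt (hG.mem_nhds hx)).differentiableAt (by simp)

/-- `DΘ` is differentiable at the points of `T`. [folklore] -/
theorem differentiableAt_fderiv_covec {x : ℝ × F} (hx : x ∈ T) :
    DifferentiableAt ℝ (fderiv ℝ Θ) x :=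
  (((hΘ.fderiv_of_isOpen (m := ∞) hG.isOpen (by simp)) x hx).contDiffAt
    (hG.mem_nhds hx)).differentiableAt (by simp)

/-- `∂_u (DΘ(·)(V)(W))(x) = D²Θ(x)(u)(V)(W)`. [folklore] -/
theorem fderiv_fderiv_covec_apply₂ {x : ℝ × F} (hx : x ∈ T) (V W u : ℝ × F) :
    fderiv ℝ (fun x' ↦ fderiv ℝ Θ x' V W) x u = fderiv ℝ (fderiv ℝ Θ) x u V W := by
  have hD := differentiableAt_fderiv_covec hG hΘ hx
  have h1 : DifferentiableAt ℝ (fun x' ↦ fderiv ℝ Θ x' V) x := differentiableAt_clm_apply_const hD V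
  rw [fderiv_clm_apply_const h1 W u, fderiv_clm_apply_const hD V u]

/-- Symmetry of the second derivative of `Θ`: `D²Θ(x)(u)(v) = D²Θ(x)(v)(u)`. [folklore] -/
theorem fderiv_fderiv_covec_comm {x : ℝ × F} (hx : x ∈ T) (u v : ℝ × F) :
    fderiv ℝ (fderiv ℝ Θ) x u v = fderiv ℝ (fderiv ℝ Θ) x v u :=
  ((hΘ x hx).contDiffAt (hG.mem_nhds hx)).isSymmSndFDerivAt two_le_infty u v

omit hΘ in
/-- `Θ(V) = G(V, ♯Θ)`. [cite: ONeill1983, Ch. 3, p. 60] -/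
theorem covec_apply_eq_metric {x : ℝ × F} (hx : x ∈ T) (V : ℝ × F) :
    Θ x V = G x V (sharpAt G x (Θ x)) := by
  rw [hG.symm x hx, apply_sharpAt_apply (hG.isInvertible x hx)]

end Smooth

section FirstOrder

variable [FiniteDimensional ℝ F]
  (hG : IsMetricOn G T) (hS : IsGaussianSlice G B) (hD : IsKIDCauchyData G Θ N Y B)
  (hΘ : ContDiffOn ℝ ∞ Θ T)
include hG hS hD hΘ

omit hΘ in
/-- **`♯Θ = 2N e₀ + Ỹ` on the slice.** [cite: FischerMarsdenMoncrief1980, Lemma 2.2] -/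
theorem sharpAt_covec (hB : IsOpen B) (hBT : ∀ y ∈ B, svec y ∈ T) (hy : y ∈ B) :
    sharpAt G (svec y) (Θ (svec y)) = (2 * N y) • (tvec : ℝ × F) + svec (Y y) := by
  have hh := isMetricOn_sliceMetric hG hS hB hBT
  have h1 : (Θ (svec y)).comp (inr ℝ ℝ F) = sliceMetric G y (Y y) := by
    ext v
    rw [ContinuousLinearMap.comp_apply, inr_apply]
    exact hD.val_svec y hy v
  rw [sharpAt_eq hG hS hB hBT hy, hD.val_tvec y hy, h1, sharpAt_apply (hh.isInvertible y hy)]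
  congr 1
  simp

omit hS hΘ in
/-- `Θ(Γ(e₀, ṽ)) = K(v, Y)` on the slice. [cite: FischerMarsdenMoncrief1980, Lemma 2.2] -/
theorem covec_chrAt_tvec_svec (hB : IsOpen B) (hBT : ∀ y ∈ B, svec y ∈ T) (hS : IsGaussianSlice G B)
    (hy : y ∈ B) (v : F) :
    Θ (svec y) (chrAt G (svec y) tvec (svec v)) = sliceK G y v (Y y) := by
  have hh := isMetricOn_sliceMetric hG hS hB hBT
  rw [chrAt_tvec_svec hG hS hB hBT hy, hD.val_svec y hy,
    apply_apply_sharpAt (hh.isInvertible y hy) (hh.symm y hy)]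

omit hS in
/-- **`DΘ(e₀)(w̃) = 2 ∂_w N + 2 K(w, Y)` on the slice** (the chosen time derivative, evaluated).
[cite: FischerMarsdenMoncrief1980, Lemma 2.2] -/
theorem fderiv_tvec_svec_eq (hB : IsOpen B) (hBT : ∀ y ∈ B, svec y ∈ T) (hS : IsGaussianSlice G B)
    (hN : ContDiffOn ℝ ∞ N B) (hy : y ∈ B) (w : F) :
    fderiv ℝ Θ (svec y) tvec (svec w) = 2 * fderiv ℝ N y w + 2 * sliceK G y w (Y y) := by
  have hNd : DifferentiableAt ℝ N y := ((hN y hy).contDiffAt (hB.mem_nhds hy)).differentiableAt (by simp)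
  rw [hD.dt_svec y hy w, fderiv_svec_tvec_eq hD hB (differentiableAt_covec hG hΘ (hBT y hy)) hNd hy,
    covec_chrAt_tvec_svec hG hD hB hBT hS hy]
  ring

/-- **`D²Θ(e₀)(ṽ)(w̃) = 2 D²N(v)(w) + 2 (∂_v K)(w, Y) + 2 K(w, ∂_v Y)` on the slice**: the
tangential derivative of the preceding identity. [cite: FischerMarsdenMoncrief1980, Lemma 2.2] -/
theorem fderiv₂_tvec_svec_svec_covec (hB : IsOpen B) (hBT : ∀ y ∈ B, svec y ∈ T)
    (hN : ContDiffOn ℝ ∞ N B) (hY : ContDiffOn ℝ ∞ Y B) (hy : y ∈ B) (v w : F) :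
    fderiv ℝ (fderiv ℝ Θ) (svec y) tvec (svec v) (svec w) =
      2 * fderiv ℝ (fderiv ℝ N) y v w + 2 * fderiv ℝ (sliceK G) y v w (Y y)
        + 2 * sliceK G y w (fderiv ℝ Y y v) := by
  have hx := hBT y hy
  rw [fderiv_fderiv_covec_comm hG hΘ hx, ← fderiv_fderiv_covec_apply₂ hG hΘ hx]
  have hd : DifferentiableAt ℝ (fun x' ↦ fderiv ℝ Θ x' tvec (svec w)) (svec y) :=
    differentiableAt_clm_apply_const
      (differentiableAt_clm_apply_const (differentiableAt_fderiv_covec hG hΘ hx) tvec) (svec w)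
  rw [← fderiv_comp_svec hd]
  have heq : (fun y' : F ↦ fderiv ℝ Θ (svec y') tvec (svec w)) =ᶠ[𝓝 y]
      fun y' ↦ 2 * fderiv ℝ N y' w + 2 * sliceK G y' w (Y y') :=
    Filter.eventually_of_mem (hB.mem_nhds hy) fun y' hy' ↦
      fderiv_tvec_svec_eq hG hD hΘ hB hBT hS hN hy' w
  rw [heq.fderiv_eq]
  have hNc : ContDiffAt ℝ ∞ N y := (hN y hy).contDiffAt (hB.mem_nhds hy)
  have hN2 : DifferentiableAt ℝ (fderiv ℝ N) y :=
    ((hNc.fderiv_right (m := ∞) (by simp)).differentiableAt (by simp))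
  have hN2w : DifferentiableAt ℝ (fun y' ↦ fderiv ℝ N y' w) y := differentiableAt_clm_apply_const hN2 w
  have hYd : DifferentiableAt ℝ Y y := ((hY y hy).contDiffAt (hB.mem_nhds hy)).differentiableAt (by simp)
  have hKd := differentiableAt_sliceK hG hBT hy
  have hKw : DifferentiableAt ℝ (fun y' ↦ sliceK G y' w) y := differentiableAt_clm_apply_const hKd w
  have hprod : HasFDerivAt (fun y' ↦ sliceK G y' w (Y y'))
      ((sliceK G y w).comp (fderiv ℝ Y y) + (fderiv ℝ (fun y' ↦ sliceK G y' w) y).flip (Y y)) y :=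
    hKw.hasFDerivAt.clm_apply hYd.hasFDerivAt
  have h1 : DifferentiableAt ℝ (fun y' ↦ 2 * fderiv ℝ N y' w) y := hN2w.const_mul _
  have h2 : DifferentiableAt ℝ (fun y' ↦ 2 * sliceK G y' w (Y y')) y := hprod.differentiableAt.const_mul _
  rw [fderiv_fun_add h1 h2, fderiv_const_mul hN2w, fderiv_const_mul hprod.differentiableAt,
    hprod.fderiv]
  simp only [_root_.add_apply, _root_.smul_apply, smul_eq_mul, ContinuousLinearMap.comp_apply,
    ContinuousLinearMap.flip_apply]
  rw [fderiv_clm_apply_const hN2 w v, fderiv_clm_apply_const hKd w v]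
  ring

omit [FiniteDimensional ℝ F] hS hD hΘ in
/-- The derivative of `K` is symmetric in the form slots. [cite: Wald1984, (10.2.13)] -/
theorem fderiv_sliceK_comm (hB : IsOpen B) (hBT : ∀ y ∈ B, svec y ∈ T) (hy : y ∈ B) (u v w : F) :
    fderiv ℝ (sliceK G) y u v w = fderiv ℝ (sliceK G) y u w v := by
  have hKd := differentiableAt_sliceK hG hBT hy
  rw [← fderiv_clm_apply_const hKd v u, ← fderiv_clm_apply_const hKd w u,
    ← fderiv_clm_apply_const (differentiableAt_clm_apply_const hKd v) w u,
    ← fderiv_clm_apply_const (differentiableAt_clm_apply_const hKd w) v u]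
  have heq : (fun y' ↦ sliceK G y' v w) =ᶠ[𝓝 y] fun y' ↦ sliceK G y' w v :=
    Filter.eventually_of_mem (hB.mem_nhds hy) fun y' hy' ↦ sliceK_comm hG hBT hy' v w
  rw [heq.fderiv_eq]

omit hS in
/-- **`DΘ(e₀)(Γ(ṽ, w̃)) = 2 ∂_{Γ_h(v,w)} N + 2 K(Γ_h(v,w), Y)` on the slice.**
[cite: FischerMarsdenMoncrief1980, Lemma 2.2] -/
theorem fderiv_tvec_chrAt_svec_svec (hB : IsOpen B) (hBT : ∀ y ∈ B, svec y ∈ T)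
    (hS : IsGaussianSlice G B) (hN : ContDiffOn ℝ ∞ N B) (hy : y ∈ B) (v w : F) :
    fderiv ℝ Θ (svec y) tvec (chrAt G (svec y) (svec v) (svec w)) =
      2 * fderiv ℝ N y (chrAt (sliceMetric G) y v w)
        + 2 * sliceK G y (chrAt (sliceMetric G) y v w) (Y y) := by
  rw [chrAt_svec_svec hG hS hB hBT hy, map_add, map_smul, hD.dt_tvec y hy, smul_zero, zero_add,
    fderiv_tvec_svec_eq hG hD hΘ hB hBT hS hN hy]

omit hΘ in
/-- **`Θ(∂_t Γ(ṽ, w̃)) = −N ∂_t∂_t G(ṽ, w̃) + ∂_v K(w, Y) + ∂_w K(Y, v) − ∂_Y K(v, w) − 2K(Γ_h(v,w), Y)`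
on the slice.** [cite: FischerMarsdenMoncrief1980, Lemma 2.2] -/
theorem covec_fderiv_chrAt_tvec [CompleteSpace F] (hB : IsOpen B) (hBT : ∀ y ∈ B, svec y ∈ T)
    (hy : y ∈ B) (v w : F) :
    Θ (svec y) (fderiv ℝ (chrAt G) (svec y) tvec (svec v) (svec w)) =
      -(N y * fderiv ℝ (fderiv ℝ G) (svec y) tvec tvec (svec v) (svec w))
        + (fderiv ℝ (sliceK G) y v w (Y y) + fderiv ℝ (sliceK G) y w (Y y) v
          - fderiv ℝ (sliceK G) y (Y y) v w)
        - 2 * sliceK G y (chrAt (sliceMetric G) y v w) (Y y) := by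
  rw [covec_apply_eq_metric hG (hBT y hy), sharpAt_covec hG hS hD hB hBT hy, map_add, map_smul,
    apply_fderiv_chrAt_tvec_tvec hG hS hB hBT hy, apply_fderiv_chrAt_tvec_svec hG hS hB hBT hy,
    smul_eq_mul]
  ring

/-- **The time derivative of the tangential block of the Killing defect on the slice**
(Fischer–Marsden–Moncrief 1980, proof of Lemma 2.2: the normal derivative of `h̄` on `Σ` is given by
the second KID equation):

  `∂_t kdef(ṽ, w̃) = 4 (Hess_h N − N Ric_h − N (tr_h K) K + 2N K(♯_h K ·, ·) + ½ 𝓛_Y K)(v, w)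
    + 4 N Ric_G(ṽ, w̃)`,

so that in vacuum (`Ric_G = 0`) it vanishes by `kid₂_eq_zero`. The Gauss–Codazzi input is
`ricAt_svec_svec` (`CoordGaussianSlice.lean`). [cite: FischerMarsdenMoncrief1980, Lemma 2.2]
[cite: Moncrief1975, §III] -/
theorem fderiv_tvec_kdef_svec_svec [CompleteSpace F] (hB : IsOpen B) (hBT : ∀ y ∈ B, svec y ∈ T)
    (hN : ContDiffOn ℝ ∞ N B) (hY : ContDiffOn ℝ ∞ Y B) (hy : y ∈ B) (v w : F) :
    fderiv ℝ (fun x ↦ kdef G Θ x (svec v) (svec w)) (svec y) tvec =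
      4 * (hessAt (sliceMetric G) N y v w - N y * ricAt (sliceMetric G) y v w
        - N y * mtrAt (sliceMetric G) y (sliceK G y) * sliceK G y v w
        + 2 * N y * sliceK G y (sharpAt (sliceMetric G) y (sliceK G y v)) w
        + 2⁻¹ * lieFormAt (sliceK G) Y y v w)
      + 4 * N y * ricAt G (svec y) (svec v) (svec w) := by
  have hx := hBT y hy
  have hh := isMetricOn_sliceMetric hG hS hB hBT
  set x₀ : ℝ × F := svec y with hx₀
  -- differentiability of the three pieces of `kdef`
  have hΘd := differentiableAt_covec hG hΘ hx
  have hDΘd := differentiableAt_fderiv_covec hG hΘ hx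
  have d1 : ∀ V W : ℝ × F, DifferentiableAt ℝ (fun x ↦ fderiv ℝ Θ x V W) x₀ := fun V W ↦
    differentiableAt_clm_apply_const (differentiableAt_clm_apply_const hDΘd V) W
  set c : ℝ × F → ℝ × F := fun x ↦ chrAt G x (svec v) (svec w) with hc
  have hcd : HasFDerivAt c ((fderiv ℝ (chrAt G) x₀).flip (svec v) |>.flip (svec w)) x₀ :=
    hasFDerivAt_clm_apply_const
      (hasFDerivAt_clm_apply_const (hG.differentiableAt_chrAt hx).hasFDerivAt (svec v)) (svec w)
  have hprod : HasFDerivAt (fun x ↦ Θ x (c x))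
      ((Θ x₀).comp ((fderiv ℝ (chrAt G) x₀).flip (svec v) |>.flip (svec w))
        + (fderiv ℝ Θ x₀).flip (c x₀)) x₀ :=
    hΘd.hasFDerivAt.clm_apply hcd
  have d3 : DifferentiableAt ℝ (fun x ↦ Θ x (c x)) x₀ := hprod.differentiableAt
  have hval3 : fderiv ℝ (fun x ↦ Θ x (c x)) x₀ tvec =
      Θ x₀ (fderiv ℝ (chrAt G) x₀ tvec (svec v) (svec w)) + fderiv ℝ Θ x₀ tvec (c x₀) := by
    rw [hprod.fderiv]
    rfl
  -- the derivative of `kdef`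
  have hsplit : (fun x ↦ kdef G Θ x (svec v) (svec w)) =
      fun x ↦ (fderiv ℝ Θ x (svec v) (svec w) + fderiv ℝ Θ x (svec w) (svec v))
        - 2 * Θ x (c x) := rfl
  have d12 : DifferentiableAt ℝ
      (fun x ↦ fderiv ℝ Θ x (svec v) (svec w) + fderiv ℝ Θ x (svec w) (svec v)) x₀ :=
    (d1 _ _).add (d1 _ _)
  have d3' : DifferentiableAt ℝ (fun x ↦ 2 * Θ x (c x)) x₀ := d3.const_mul _
  rw [hsplit, fderiv_fun_sub d12 d3', fderiv_fun_add (d1 _ _) (d1 _ _), fderiv_const_mul d3]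
  simp only [_root_.sub_apply, _root_.add_apply, _root_.smul_apply, smul_eq_mul]
  rw [fderiv_fderiv_covec_apply₂ hG hΘ hx, fderiv_fderiv_covec_apply₂ hG hΘ hx, hval3,
    fderiv₂_tvec_svec_svec_covec hG hS hD hΘ hB hBT hN hY hy v w,
    fderiv₂_tvec_svec_svec_covec hG hS hD hΘ hB hBT hN hY hy w v,
    covec_fderiv_chrAt_tvec hG hS hD hB hBT hy v w,
    show c x₀ = chrAt G x₀ (svec v) (svec w) from rfl,
    fderiv_tvec_chrAt_svec_svec hG hD hΘ hB hBT hS hN hy v w]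
  -- the algebra
  have hR := ricAt_svec_svec hG hS hB hBT hy v w
  have hHess : hessAt (sliceMetric G) N y v w =
      fderiv ℝ (fderiv ℝ N) y v w - fderiv ℝ N y (chrAt (sliceMetric G) y v w) := hessAt_apply _ _ _ _ _
  have hNsymm : fderiv ℝ (fderiv ℝ N) y w v = fderiv ℝ (fderiv ℝ N) y v w :=
    ((hN y hy).contDiffAt (hB.mem_nhds hy)).isSymmSndFDerivAt two_le_infty w v
  have hLie : lieFormAt (sliceK G) Y y v w = fderiv ℝ (sliceK G) y (Y y) v w
      + sliceK G y (fderiv ℝ Y y v) w + sliceK G y v (fderiv ℝ Y y w) := lieFormAt_apply _ _ _ _ _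
  have hK1 : sliceK G y w (fderiv ℝ Y y v) = sliceK G y (fderiv ℝ Y y v) w := sliceK_comm hG hBT hy _ _
  have hK2 : fderiv ℝ (sliceK G) y w (Y y) v = fderiv ℝ (sliceK G) y w v (Y y) :=
    fderiv_sliceK_comm hG hB hBT hy _ _ _
  have hK3 : sliceK G y w (sharpAt (sliceMetric G) y (sliceK G y v)) =
      sliceK G y (sharpAt (sliceMetric G) y (sliceK G y v)) w := sliceK_comm hG hBT hy _ _
  rw [hHess, hLie]
  linear_combination (-4 * N y) * hR + 2 * hNsymm + 2 * hK1 + (-2) * hK2 + (8 * N y) * hK3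

end FirstOrder

/-! ### The normal rows and the vanishing of the Cauchy data of `A = deform Θ` -/

section NormalRows

variable [FiniteDimensional ℝ F] [CompleteSpace F] {ι : Type*} [Fintype ι] (b₀ : Basis ι ℝ F)
  (hG : IsMetricOn G T) (hS : IsGaussianSlice G B)
include hG hS

/-- **The normal rows of `∂_t A` vanish on the slice**: if all components of `A = deform Θ`
vanish on the slice, the time derivatives of its tangential components vanish at `(0, y)`, and
`□Θ = 0`, `Ric_G = 0` at `(0, y)`, then every component of `∂_t A` vanishes at `(0, y)` — the
contracted Ricci identity `div A − ½ d(tr A) = □Θ + Ric(Θ♯, ·)` (`trace_tcov_deform_sub_half`)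
read at a point of the slice with `g⁰⁰ = −1`, `g⁰ⁱ = 0` (Fischer–Marsden–Moncrief 1980, proof of
Lemma 2.2, "the normal derivative of `h̄` vanishes on `Σ` by `□X = 0` and the constraints").
[cite: FischerMarsdenMoncrief1980, Lemma 2.2] -/
theorem fderiv_tvec_deform_none (hB : IsOpen B) (hBT : ∀ y ∈ B, svec y ∈ T)
    (hΘ : ContDiffOn ℝ ∞ Θ T) (hy : y ∈ B)
    (hA0 : ∀ y' ∈ B, ∀ J, deform G (sliceBasis b₀) (covecComp (sliceBasis b₀) Θ) (svec y') J = 0)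
    (hAt : ∀ i j : ι, fderiv ℝ (fun x ↦ deform G (sliceBasis b₀) (covecComp (sliceBasis b₀) Θ) x
      (ocons (some i) (uidx (some j)))) (svec y) tvec = 0)
    (hwave : ∀ I, tlap G (sliceBasis b₀) (covecComp (sliceBasis b₀) Θ) (svec y) I = 0)
    (hRic : ricAt G (svec y) = 0) (a c : Option ι) :
    fderiv ℝ (fun x ↦ deform G (sliceBasis b₀) (covecComp (sliceBasis b₀) Θ) x (ocons a (uidx c)))
      (svec y) tvec = 0 := by
  classical
  set bE := sliceBasis b₀ with hbE
  set A := deform G bE (covecComp bE Θ) with hA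
  have hx := hBT y hy
  have hAs : TSmoothOn A T := hG.tsmoothOn_deform (tsmoothOn_covecComp (b := bE) hΘ)
  set dA : Option ι → Option ι → ℝ := fun p q ↦ fderiv ℝ (fun x ↦ A x (ocons p (uidx q))) (svec y) tvec
    with hdA
  -- tangential derivatives of the components vanish on the slice
  have htan : ∀ (J : Option Unit → Option ι) (i : ι), fderiv ℝ (fun x ↦ A x J) (svec y) (svec (b₀ i)) = 0 := by
    intro J i
    rw [← fderiv_comp_svec (hAs.differentiableAt hG.isOpen hx J),
      fderiv_eq_zero_of_eqOn_const hB (c := (0 : ℝ)) (fun y' hy' ↦ hA0 y' hy' J) hy]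
    rfl
  -- the covariant derivative of `A` at the slice point is the coordinate derivative
  have htcov : ∀ (p : Option ι) (J : Option Unit → Option ι),
      tcov G bE A (svec y) (ocons p J) = fderiv ℝ (fun x ↦ A x J) (svec y) (bE p) := by
    intro p J
    rw [tcov_apply_ocons, Finset.sum_eq_zero fun s _ ↦ Finset.sum_eq_zero fun m _ ↦ by
      rw [hA0 y hy, mul_zero], sub_zero]
  have htcov_none : ∀ q e : Option ι, tcov G bE A (svec y) (ocons none (ocons q (uidx e))) = dA q e := by
    intro q e; rw [htcov, hbE, sliceBasis_none]
  have htcov_some : ∀ (i : ι) (J : Option Unit → Option ι), tcov G bE A (svec y) (ocons (some i) J) = 0 := by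
    intro i J; rw [htcov, hbE, sliceBasis_some, htan]
  -- the symmetric components
  have hdA_comm : ∀ p q, dA p q = dA q p := fun p q ↦ by
    simp only [hdA, hA, deform_comm]
  have hdA_ss : ∀ i j : ι, dA (some i) (some j) = 0 := fun i j ↦ hAt i j
  -- the contracted Ricci identity at the slice point
  have key : ∀ e : Option ι,
      -dA none e - (1 / 2) * ∑ p, ∑ q, ginv G bE (svec y) p q *
        tcov G bE A (svec y) (ocons e (ocons p (uidx q))) = 0 := by
    intro e
    have h := hG.trace_tcov_deform_sub_half (b := bE) (tsmoothOn_covecComp (b := bE) hΘ) hx e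
    rw [hRic] at h
    simp only [_root_.zero_apply, zero_mul, mul_zero, Finset.sum_const_zero, add_zero, hwave] at h
    rw [← hA, sum_ginv_mul b₀ hG hS hB hBT hy] at h
    simp only [htcov_none, htcov_some, mul_zero, Finset.sum_const_zero, add_zero] at h
    rw [hbE]
    exact h
  -- the `e₀`–`e₀` component
  have h00 : dA none none = 0 := by
    have h := key none
    rw [sum_ginv_mul b₀ hG hS hB hBT hy] at h
    simp only [htcov_none, hdA_ss, mul_zero, Finset.sum_const_zero, add_zero] at h
    linarith
  -- the `e₀`–tangential components
  have h0s : ∀ k : ι, dA none (some k) = 0 := by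
    intro k
    have h := key (some k)
    simp only [htcov_some, mul_zero, Finset.sum_const_zero, sub_zero] at h
    linarith
  show dA a c = 0
  rcases a with _ | i <;> rcases c with _ | k
  · exact h00
  · exact h0s k
  · rw [hdA_comm]; exact h0s i
  · exact hdA_ss i k

/-- **Killing initial data give vanishing Cauchy data for the Killing defect** (Moncrief 1975,
§III; Fischer–Marsden–Moncrief 1980, Lemma 2.2, first half of the proof). Let `G` be a vacuum
metric (`Ric_G = 0` on the slice) in second-order Gaussian form along the slice `{0} × B`
(`dim F ≠ 1`), whose induced data `(h, K) = (sliceMetric G, sliceK G)` satisfy the vacuum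
constraints on `B`, let `(N, Y)` solve the KID equations of `(h, K)` on `B` (the tree's
`adjHamK + adjMomKS = 0`, `adjHamG + adjMomGS = 0`), and let `Θ` be a smooth covector field with
the KID Cauchy data of `(N, Y)` (`IsKIDCauchyData`) solving the wave equation `□Θ = 0` at the
slice. Then **every component of `A = deform Θ = ∇Θ + (∇Θ)ᵗ` and of `∂_t A` vanishes on the
slice.** [cite: FischerMarsdenMoncrief1980, Lemma 2.2] [cite: Moncrief1975, §III] -/
theorem deform_cauchyData_eq_zero (hB : IsOpen B) (hBT : ∀ y ∈ B, svec y ∈ T)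
    (hn : finrank ℝ F ≠ 1) (hRic : ∀ y ∈ B, ricAt G (svec y) = 0)
    (hΘ : ContDiffOn ℝ ∞ Θ T) (hD : IsKIDCauchyData G Θ N Y B)
    (hN : ContDiffOn ℝ ∞ N B) (hY : ContDiffOn ℝ ∞ Y B)
    (hkid₁ : ∀ y ∈ B, adjHamK (sliceMetric G) (sliceK G) N y + adjMomKS (sliceMetric G) Y y = 0)
    (hkid₂ : ∀ y ∈ B,
      adjHamG (sliceMetric G) (sliceK G) N y + adjMomGS (sliceMetric G) (sliceK G) Y y = 0)
    (hham : ∀ y ∈ B, hamAt (sliceMetric G) (sliceK G) y = 0)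
    (hmom : ∀ y ∈ B, momFn b₀ (sliceMetric G) (sliceK G) y (Y y) = 0)
    (hwave : ∀ y ∈ B, ∀ I, tlap G (sliceBasis b₀) (covecComp (sliceBasis b₀) Θ) (svec y) I = 0)
    (hy : y ∈ B) (a c : Option ι) :
    deform G (sliceBasis b₀) (covecComp (sliceBasis b₀) Θ) (svec y) (ocons a (uidx c)) = 0 ∧
      fderiv ℝ (fun x ↦ deform G (sliceBasis b₀) (covecComp (sliceBasis b₀) Θ) x (ocons a (uidx c)))
        (svec y) tvec = 0 := by
  have hh := isMetricOn_sliceMetric hG hS hB hBT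
  set bE := sliceBasis b₀ with hbE
  -- differentiability of the data
  have hΘd : ∀ y' ∈ B, DifferentiableAt ℝ Θ (svec y') := fun y' hy' ↦
    differentiableAt_covec hG hΘ (hBT y' hy')
  have hYd : ∀ y' ∈ B, DifferentiableAt ℝ Y y' := fun y' hy' ↦
    ((hY y' hy').contDiffAt (hB.mem_nhds hy')).differentiableAt (by simp)
  -- zeroth order: the components of `A` on the slice are the Killing defect on basis vectors
  have hA0' : ∀ y' ∈ B, ∀ p q : Option ι, deform G bE (covecComp bE Θ) (svec y') (ocons p (uidx q)) = 0 := by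
    intro y' hy' p q
    rw [hG.deform_covecComp (hBT y' hy') (hΘd y' hy')]
    rcases p with _ | i <;> rcases q with _ | j
    · rw [hbE, sliceBasis_none]; exact kdef_tvec_tvec hG hD hB hBT hS hy'
    · rw [hbE, sliceBasis_none, sliceBasis_some]; exact kdef_tvec_svec hD hy' _
    · rw [hbE, sliceBasis_none, sliceBasis_some]; exact kdef_svec_tvec hG hD hBT hy' _
    · rw [hbE, sliceBasis_some, sliceBasis_some,
        kdef_svec_svec hG hS hD hB hBT (hΘd y' hy') (hYd y' hy') hy',
        hh.lieFormAt_metric_eq_of_kidK hy' hn (hkid₁ y' hy')]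
      simp only [_root_.smul_apply, smul_eq_mul]
      ring
  have hA0 : ∀ y' ∈ B, ∀ J, deform G bE (covecComp bE Θ) (svec y') J = 0 := by
    intro y' hy' J
    obtain ⟨p, q, rfl⟩ := exists_eq_ocons_uidx J
    exact hA0' y' hy' p q
  -- first order, tangential block: the second KID equation
  have hAt : ∀ i j : ι, fderiv ℝ (fun x ↦ deform G bE (covecComp bE Θ) x
      (ocons (some i) (uidx (some j)))) (svec y) tvec = 0 := by
    intro i j
    have heq : (fun x ↦ deform G bE (covecComp bE Θ) x (ocons (some i) (uidx (some j)))) =ᶠ[𝓝 (svec y)]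
        fun x ↦ kdef G Θ x (svec (b₀ i)) (svec (b₀ j)) :=
      (hG.eventually_mem (hBT y hy)).mono fun x hx ↦ by
        show deform G bE (covecComp bE Θ) x (ocons (some i) (uidx (some j))) = _
        rw [hG.deform_covecComp hx (differentiableAt_covec hG hΘ hx), hbE, sliceBasis_some,
          sliceBasis_some]
    rw [heq.fderiv_eq, fderiv_tvec_kdef_svec_svec hG hS hD hΘ hB hBT hN hY hy, hRic y hy,
      _root_.zero_apply, _root_.zero_apply, mul_zero, add_zero]
    have hk := hh.kid₂_eq_zero (b := b₀) hy hn (differentiableAt_sliceK hG hBT hy)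
      (fun y' hy' v w ↦ sliceK_comm hG hBT hy' v w) (hYd y hy) (hkid₁ y hy) (hkid₂ y hy)
      (hham y hy) (hmom y hy)
    have hk' := congrArg (fun β : F →L[ℝ] F →L[ℝ] ℝ ↦ β (b₀ i) (b₀ j)) hk
    simp only [_root_.add_apply, _root_.sub_apply, _root_.smul_apply, smul_eq_mul,
      ContinuousLinearMap.comp_apply, _root_.zero_apply] at hk'
    linear_combination 4 * hk'
  refine ⟨hA0' y hy a c, ?_⟩
  exact fderiv_tvec_deform_none b₀ hG hS hB hBT hΘ hy hA0 hAt (hwave y hy) (hRic y hy) a c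

end NormalRows

end GaussSlice

end MetricCoord

end Literature.Geometry.Lorentzian

end
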